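import Literature.Probability.RandomPlanarGeometry.SAWBrickWallHex
import HarnessLib

/-!
# Decoding the horizontal double-brick join on the honeycomb lattice: the horizontal cut of an equal-split merge is unique (shape FF)

Topic `Literature/Probability/RandomPlanarGeometry` (lane «pcv-sawmu», a-p4 g13; sequel of TREE `HexSAWPolygonJoinDecode.lean` (one brick,
`isBrickCut_unique`) and of `HexSAWPolygonStaggeredCut.lean` (staggered double brick)).

Context.  In the capless Madras join on the brick wall `ℍ` (N. Madras, J. Stat. Phys. 78 (1995) §2; A. Hammond, arXiv:1504.05286v5 §4.1,
Definition 4.3 p. 20) a first touch at horizontal distance `2` with the right polygon one row up is merged across a HORIZONTAL DOUBLE BRICK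
(contact type T3 of `HexSAWPolygonJunctions.hdJoin`): `t` the contact site of the left polygon `P` (bond `t – b`, `b = t − (1,0)`), `w′ = t + (2,1)`
the facing site of the right polygon `Q` (bond `c – w′`, `c = t + (3,1)`).  In the basic shape FF (`t + (−1,1) ∉ P`, `t + (3,0) ∉ Q`) the joined
polygon reads, cyclically, `b → (P ∖ bt) → t → t+(1,0) → t+(2,0) → t+(3,0) → c → (Q ∖ cw′) → w′ → t+(1,1) → t+(0,1) → t+(−1,1) → b`, a
`2M`-periodic site sequence (`M = |P| + 3`).  A HORIZONTAL CUT at `j` (`IsHdCut M v j`, forward reading, base `v j = b`) records this shape together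
with «the block `v[j, j+M)` lies strictly left of the block `v[j+M, j+2M)` in every row»; `IsHdCut' M v j` is the backward reading (base
`v j = t + (−1,1)`, right block first).  **The cut is unique** (`isHdCut_unique`) and **forward and backward cuts never coexist**
(`not_isHdCut'_of_isHdCut`).  The proofs run through one generic device, `HexBW.sep_contra`: two index arcs whose row ranges overlap carry a
same-row pair (discrete intermediate value property), which two opposite separations forbid.

## What is proved (namespace `…SAW.HexBW`; all `theorem`s, axioms standard)
* generic: `exists_row_eq_of_between'` (IVT, local), **`sep_contra`** (two arcs with overlapping row ranges contradict opposite separations);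
* `IsHdCut`, `IsHdCut'`; `isHdCut_shift/_add_period`, `isHdCut'_shift/_add_period`;
* `not_isHdCut_of_zero`, **`isHdCut_unique`**; `not_isHdCut'_of_isHdCut_zero`, **`not_isHdCut'_of_isHdCut`**.
[cite: Hammond2015SAPJoining, Definition 4.3 and §4.2 (arXiv v5 pp. 20–24: junction plaquette; global join plaquettes)]
[cite: Madras1995LatticeAnimalsExponent, §2 (primary, not held by the lane)] [cite: MadrasSlade1993, Theorem 3.2.3 proof (pp. 64–65: decoding a
polygon concatenation)].  Label (expected): NEW-IN-WRITING (modest), technique class Madras join.  The shapes TF/FT/TT (the bits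
`t + (−1,1) ∈ P`, `t + (3,0) ∈ Q`) are the subject of a sequel; `sep_contra` is stated for reuse there.
-/

noncomputable section

open Literature.Probability.LatticeModels

namespace Literature.Probability.RandomPlanarGeometry.SAW

namespace HexBW

variable {M : ℕ} {v : ℕ → Site 2}

/-! ### Generic: the discrete intermediate value property and the two-arc contradiction -/

/-- Discrete intermediate value property of the rows, inductive form (local). [folklore] -/
private theorem exists_row_eq_aux' (hrow : ∀ i, v (i + 1) 1 ≤ v i 1 + 1 ∧ v i 1 ≤ v (i + 1) 1 + 1) (a : ℕ) :
    ∀ (n : ℕ) {y : ℤ}, (v a 1 ≤ y ∧ y ≤ v (a + n) 1) ∨ (v (a + n) 1 ≤ y ∧ y ≤ v a 1) →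
      ∃ c, a ≤ c ∧ c ≤ a + n ∧ v c 1 = y := by
  intro n
  induction n with
  | zero =>
    intro y hy
    simp only [Nat.add_zero] at hy
    exact ⟨a, le_rfl, by omega, by omega⟩
  | succ n ih =>
    intro y hy
    simp only [← Nat.add_assoc] at hy ⊢
    have hs := hrow (a + n)
    by_cases h : (v a 1 ≤ y ∧ y ≤ v (a + n) 1) ∨ (v (a + n) 1 ≤ y ∧ y ≤ v a 1)
    · obtain ⟨c, hc1, hc2, hc3⟩ := ih h
      exact ⟨c, hc1, by omega, hc3⟩
    · exact ⟨a + n + 1, by omega, le_rfl, by omega⟩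

/-- Discrete intermediate value property: every row between the rows of `v a` and `v c` (`a ≤ c`) is attained on `[a, c]` (local restatement
of `HexSAWPolygonJoinDecode.exists_row_eq'`). [folklore] -/
private theorem exists_row_eq_of_between' (hrow : ∀ i, v (i + 1) 1 ≤ v i 1 + 1 ∧ v i 1 ≤ v (i + 1) 1 + 1) {a c : ℕ} (hac : a ≤ c) {y : ℤ}
    (hy : (v a 1 ≤ y ∧ y ≤ v c 1) ∨ (v c 1 ≤ y ∧ y ≤ v a 1)) : ∃ b, a ≤ b ∧ b ≤ c ∧ v b 1 = y := by
  obtain ⟨n, rfl⟩ := Nat.exists_eq_add_of_le hac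
  exact exists_row_eq_aux' hrow a n hy

/-- **Two-arc contradiction.**  If the index arcs `[a₁, a₂]` and `[b₁, b₂]` both reach the row `r` (it lies between the rows of their end sites),
and same-row pairs are ordered one way by one separation and the other way by another, we have a contradiction.  This is the engine of every
cut-uniqueness proof on `ℍ` (rows move by at most one per step). [cite: Hammond2015SAPJoining, §4.2 (arXiv v5 pp. 20–24); lane device] -/
theorem sep_contra (hrow : ∀ i, v (i + 1) 1 ≤ v i 1 + 1 ∧ v i 1 ≤ v (i + 1) 1 + 1) {a₁ a₂ b₁ b₂ : ℕ} (ha : a₁ ≤ a₂) (hb : b₁ ≤ b₂) (r : ℤ)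
    (hrA : (v a₁ 1 ≤ r ∧ r ≤ v a₂ 1) ∨ (v a₂ 1 ≤ r ∧ r ≤ v a₁ 1)) (hrB : (v b₁ 1 ≤ r ∧ r ≤ v b₂ 1) ∨ (v b₂ 1 ≤ r ∧ r ≤ v b₁ 1))
    (h₁ : ∀ a b, a₁ ≤ a → a ≤ a₂ → b₁ ≤ b → b ≤ b₂ → v a 1 = v b 1 → v a 0 < v b 0)
    (h₂ : ∀ a b, a₁ ≤ a → a ≤ a₂ → b₁ ≤ b → b ≤ b₂ → v a 1 = v b 1 → v b 0 < v a 0) : False := by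
  obtain ⟨a, ha1, ha2, har⟩ := exists_row_eq_of_between' hrow ha hrA
  obtain ⟨b, hb1, hb2, hbr⟩ := exists_row_eq_of_between' hrow hb hrB
  have e : v a 1 = v b 1 := by rw [har, hbr]
  have := h₁ a b ha1 ha2 hb1 hb2 e
  have := h₂ a b ha1 ha2 hb1 hb2 e
  omega

/-! ### The horizontal double-brick cut, shape FF -/

/-- **Horizontal cut, forward reading** (shape FF) of a `2M`-periodic site sequence at `j` (base `s = v j = b = t − (1,0)`): the left block
`v[j, j+M)` is `b, (P-arc), t = s+(1,0), s+(2,0), s+(3,0), s+(4,0)`, the right block `v[j+M, j+2M)` is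
`c = s+(4,1), (Q-arc), w′ = s+(3,1), s+(2,1), s+(1,1), s+(0,1)`, and the left block lies strictly left of the right block in every row.
[cite: Hammond2015SAPJoining, Definition 4.3 (arXiv v5 p. 20: the junction plaquette; here a horizontal two-brick cluster)] -/
def IsHdCut (M : ℕ) (v : ℕ → Site 2) (j : ℕ) : Prop :=
  (v (j + M - 4) 0 = v j 0 + 1 ∧ v (j + M - 4) 1 = v j 1) ∧
  (v (j + M - 3) 0 = v j 0 + 2 ∧ v (j + M - 3) 1 = v j 1) ∧
  (v (j + M - 2) 0 = v j 0 + 3 ∧ v (j + M - 2) 1 = v j 1) ∧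
  (v (j + M - 1) 0 = v j 0 + 4 ∧ v (j + M - 1) 1 = v j 1) ∧
  (v (j + M) 0 = v j 0 + 4 ∧ v (j + M) 1 = v j 1 + 1) ∧
  (v (j + 2 * M - 4) 0 = v j 0 + 3 ∧ v (j + 2 * M - 4) 1 = v j 1 + 1) ∧
  (v (j + 2 * M - 3) 0 = v j 0 + 2 ∧ v (j + 2 * M - 3) 1 = v j 1 + 1) ∧
  (v (j + 2 * M - 2) 0 = v j 0 + 1 ∧ v (j + 2 * M - 2) 1 = v j 1 + 1) ∧
  (v (j + 2 * M - 1) 0 = v j 0 ∧ v (j + 2 * M - 1) 1 = v j 1 + 1) ∧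
  ∀ a b : ℕ, j ≤ a → a < j + M → j + M ≤ b → b < j + 2 * M → v a 1 = v b 1 → v a 0 < v b 0

/-- **Horizontal cut, backward reading** (shape FF) at `j` (base `r = v j = t + (−1,1)`): the first block `v[j, j+M)` is
`r, r+(1,0), r+(2,0), w′ = r+(3,0), (Q-arc), c = r+(4,0)`, the second block `v[j+M, j+2M)` is `r+(4,−1), r+(3,−1), r+(2,−1), t = r+(1,−1), (P-arc),
b = r+(0,−1)`, and the FIRST block lies strictly RIGHT of the second in every row. [cite: Hammond2015SAPJoining, Definition 4.3 (arXiv v5 p. 20)] -/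
def IsHdCut' (M : ℕ) (v : ℕ → Site 2) (j : ℕ) : Prop :=
  (v (j + 1) 0 = v j 0 + 1 ∧ v (j + 1) 1 = v j 1) ∧
  (v (j + 2) 0 = v j 0 + 2 ∧ v (j + 2) 1 = v j 1) ∧
  (v (j + 3) 0 = v j 0 + 3 ∧ v (j + 3) 1 = v j 1) ∧
  (v (j + M - 1) 0 = v j 0 + 4 ∧ v (j + M - 1) 1 = v j 1) ∧
  (v (j + M) 0 = v j 0 + 4 ∧ v (j + M) 1 + 1 = v j 1) ∧
  (v (j + M + 1) 0 = v j 0 + 3 ∧ v (j + M + 1) 1 + 1 = v j 1) ∧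
  (v (j + M + 2) 0 = v j 0 + 2 ∧ v (j + M + 2) 1 + 1 = v j 1) ∧
  (v (j + M + 3) 0 = v j 0 + 1 ∧ v (j + M + 3) 1 + 1 = v j 1) ∧
  (v (j + 2 * M - 1) 0 = v j 0 ∧ v (j + 2 * M - 1) 1 + 1 = v j 1) ∧
  ∀ a b : ℕ, j ≤ a → a < j + M → j + M ≤ b → b < j + 2 * M → v a 1 = v b 1 → v b 0 < v a 0

/-! ### Symmetries -/

/-- Re-indexing: a forward cut of `v` at `c + j` is a forward cut of `v (· + c)` at `j`. [cite: Hammond2015SAPJoining, Definition 4.3 (arXiv v5 p. 20)] -/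
theorem isHdCut_shift {c j : ℕ} (hM : 5 ≤ M) (h : IsHdCut M v (c + j)) : IsHdCut M (fun i => v (i + c)) j := by
  obtain ⟨⟨a0, a1⟩, ⟨b0, b1⟩, ⟨c0, c1⟩, ⟨d0, d1⟩, ⟨e0, e1⟩, ⟨f0, f1⟩, ⟨g0, g1⟩, ⟨h0, h1⟩, ⟨i0, i1⟩, sep⟩ := h
  have E : ∀ k l : ℕ, l = c + k → v (k + c) = v l := fun k l hl => by rw [hl, Nat.add_comm]
  rw [IsHdCut, E (j + M - 4) (c + j + M - 4) (by omega), E (j + M - 3) (c + j + M - 3) (by omega), E (j + M - 2) (c + j + M - 2) (by omega),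
    E (j + M - 1) (c + j + M - 1) (by omega), E (j + M) (c + j + M) (by omega), E (j + 2 * M - 4) (c + j + 2 * M - 4) (by omega),
    E (j + 2 * M - 3) (c + j + 2 * M - 3) (by omega), E (j + 2 * M - 2) (c + j + 2 * M - 2) (by omega),
    E (j + 2 * M - 1) (c + j + 2 * M - 1) (by omega), E j (c + j) rfl]
  refine ⟨⟨a0, a1⟩, ⟨b0, b1⟩, ⟨c0, c1⟩, ⟨d0, d1⟩, ⟨e0, e1⟩, ⟨f0, f1⟩, ⟨g0, g1⟩, ⟨h0, h1⟩, ⟨i0, i1⟩, fun a b ha1 ha2 hb1 hb2 hr => ?_⟩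
  exact sep (a + c) (b + c) (by omega) (by omega) (by omega) (by omega) hr

/-- Periodicity: a forward cut at `j` is a forward cut at `j + 2M`. [cite: Hammond2015SAPJoining, Definition 4.3 (arXiv v5 p. 20)] -/
theorem isHdCut_add_period {j : ℕ} (hM : 5 ≤ M) (hper : ∀ i, v (i + 2 * M) = v i) (h : IsHdCut M v j) : IsHdCut M v (j + 2 * M) := by
  obtain ⟨⟨a0, a1⟩, ⟨b0, b1⟩, ⟨c0, c1⟩, ⟨d0, d1⟩, ⟨e0, e1⟩, ⟨f0, f1⟩, ⟨g0, g1⟩, ⟨h0, h1⟩, ⟨i0, i1⟩, sep⟩ := h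
  have E : ∀ i k : ℕ, k = i + 2 * M → v k = v i := fun i k hk => by rw [hk, hper]
  rw [IsHdCut, E (j + M - 4) (j + 2 * M + M - 4) (by omega), E (j + M - 3) (j + 2 * M + M - 3) (by omega),
    E (j + M - 2) (j + 2 * M + M - 2) (by omega), E (j + M - 1) (j + 2 * M + M - 1) (by omega), E (j + M) (j + 2 * M + M) (by omega),
    E (j + 2 * M - 4) (j + 2 * M + 2 * M - 4) (by omega), E (j + 2 * M - 3) (j + 2 * M + 2 * M - 3) (by omega),
    E (j + 2 * M - 2) (j + 2 * M + 2 * M - 2) (by omega), E (j + 2 * M - 1) (j + 2 * M + 2 * M - 1) (by omega), E j (j + 2 * M) rfl]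
  refine ⟨⟨a0, a1⟩, ⟨b0, b1⟩, ⟨c0, c1⟩, ⟨d0, d1⟩, ⟨e0, e1⟩, ⟨f0, f1⟩, ⟨g0, g1⟩, ⟨h0, h1⟩, ⟨i0, i1⟩, fun a b ha1 ha2 hb1 hb2 hr => ?_⟩
  have ha := E (a - 2 * M) a (by omega)
  have hb := E (b - 2 * M) b (by omega)
  rw [ha, hb] at hr ⊢
  exact sep _ _ (by omega) (by omega) (by omega) (by omega) hr

/-- Re-indexing for the backward cut. [cite: Hammond2015SAPJoining, Definition 4.3 (arXiv v5 p. 20)] -/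
theorem isHdCut'_shift {c j : ℕ} (hM : 5 ≤ M) (h : IsHdCut' M v (c + j)) : IsHdCut' M (fun i => v (i + c)) j := by
  obtain ⟨⟨a0, a1⟩, ⟨b0, b1⟩, ⟨c0, c1⟩, ⟨d0, d1⟩, ⟨e0, e1⟩, ⟨f0, f1⟩, ⟨g0, g1⟩, ⟨h0, h1⟩, ⟨i0, i1⟩, sep⟩ := h
  have E : ∀ k l : ℕ, l = c + k → v (k + c) = v l := fun k l hl => by rw [hl, Nat.add_comm]
  rw [IsHdCut', E (j + 1) (c + j + 1) (by omega), E (j + 2) (c + j + 2) (by omega), E (j + 3) (c + j + 3) (by omega),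
    E (j + M - 1) (c + j + M - 1) (by omega), E (j + M) (c + j + M) (by omega), E (j + M + 1) (c + j + M + 1) (by omega),
    E (j + M + 2) (c + j + M + 2) (by omega), E (j + M + 3) (c + j + M + 3) (by omega),
    E (j + 2 * M - 1) (c + j + 2 * M - 1) (by omega), E j (c + j) rfl]
  refine ⟨⟨a0, a1⟩, ⟨b0, b1⟩, ⟨c0, c1⟩, ⟨d0, d1⟩, ⟨e0, e1⟩, ⟨f0, f1⟩, ⟨g0, g1⟩, ⟨h0, h1⟩, ⟨i0, i1⟩, fun a b ha1 ha2 hb1 hb2 hr => ?_⟩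
  exact sep (a + c) (b + c) (by omega) (by omega) (by omega) (by omega) hr

/-- Periodicity for the backward cut. [cite: Hammond2015SAPJoining, Definition 4.3 (arXiv v5 p. 20)] -/
theorem isHdCut'_add_period {j : ℕ} (hM : 5 ≤ M) (hper : ∀ i, v (i + 2 * M) = v i) (h : IsHdCut' M v j) :
    IsHdCut' M v (j + 2 * M) := by
  obtain ⟨⟨a0, a1⟩, ⟨b0, b1⟩, ⟨c0, c1⟩, ⟨d0, d1⟩, ⟨e0, e1⟩, ⟨f0, f1⟩, ⟨g0, g1⟩, ⟨h0, h1⟩, ⟨i0, i1⟩, sep⟩ := h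
  have E : ∀ i k : ℕ, k = i + 2 * M → v k = v i := fun i k hk => by rw [hk, hper]
  rw [IsHdCut', E (j + 1) (j + 2 * M + 1) (by omega), E (j + 2) (j + 2 * M + 2) (by omega), E (j + 3) (j + 2 * M + 3) (by omega),
    E (j + M - 1) (j + 2 * M + M - 1) (by omega), E (j + M) (j + 2 * M + M) (by omega), E (j + M + 1) (j + 2 * M + M + 1) (by omega),
    E (j + M + 2) (j + 2 * M + M + 2) (by omega), E (j + M + 3) (j + 2 * M + M + 3) (by omega),
    E (j + 2 * M - 1) (j + 2 * M + 2 * M - 1) (by omega), E j (j + 2 * M) rfl]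
  refine ⟨⟨a0, a1⟩, ⟨b0, b1⟩, ⟨c0, c1⟩, ⟨d0, d1⟩, ⟨e0, e1⟩, ⟨f0, f1⟩, ⟨g0, g1⟩, ⟨h0, h1⟩, ⟨i0, i1⟩, fun a b ha1 ha2 hb1 hb2 hr => ?_⟩
  have ha := E (a - 2 * M) a (by omega)
  have hb := E (b - 2 * M) b (by omega)
  rw [ha, hb] at hr ⊢
  exact sep _ _ (by omega) (by omega) (by omega) (by omega) hr

/-! ### Uniqueness of the forward cut -/

/-- Core case: a forward cut at `0` excludes a forward cut at any `1 ≤ j ≤ M`.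
[cite: Hammond2015SAPJoining, §4.2 (arXiv v5 pp. 20–24: global join plaquettes; here unique, for row-separated joins)] -/
theorem not_isHdCut_of_zero (hM : 5 ≤ M) (hper : ∀ i, v (i + 2 * M) = v i)
    (hrow : ∀ i, v (i + 1) 1 ≤ v i 1 + 1 ∧ v i 1 ≤ v (i + 1) 1 + 1) (h0 : IsHdCut M v 0) {j : ℕ} (hj1 : 1 ≤ j) (hjM : j ≤ M)
    (hj : IsHdCut M v j) : False := by
  obtain ⟨⟨a0, a1⟩, ⟨b0, b1⟩, ⟨c0, c1⟩, ⟨d0, d1⟩, ⟨e0, e1⟩, ⟨f0, f1⟩, ⟨g0, g1⟩, ⟨h0, h1⟩, ⟨i0, i1⟩, sep0⟩ := h0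
  obtain ⟨⟨aj0, aj1⟩, ⟨bj0, bj1⟩, ⟨cj0, cj1⟩, ⟨dj0, dj1⟩, ⟨ej0, ej1⟩, ⟨fj0, fj1⟩, ⟨gj0, gj1⟩, ⟨hj0, hj1'⟩, ⟨ij0, ij1⟩, sepj⟩ := hj
  simp only [Nat.zero_add] at a0 a1 b0 b1 c0 c1 d0 d1 e0 e1 f0 f1 g0 g1 h0 h1 i0 i1 sep0
  by_cases hjM' : j = M
  · subst hjM'
    rw [show j + j - 4 = 2 * j - 4 by omega] at aj0
    omega
  by_cases hj1' : j = 1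
  · subst hj1'
    rw [show 1 + 2 * M - 1 = 0 + 2 * M by omega, hper] at ij1
    rw [show 1 + M - 1 = M by omega] at dj1
    omega
  -- `2 ≤ j ≤ M − 1`: the arcs `A = [0, j−1]` (rows from `y₀` to `y_j + 1`) and `B = [M, M+j−1]` (rows from `y₀ + 1` to `y_j`) overlap in rows
  have hj2 : 2 ≤ j := by omega
  have Rj1 : v (j - 1) 1 = v j 1 + 1 := by rw [show j + 2 * M - 1 = (j - 1) + 2 * M by omega, hper] at ij1; exact ij1
  have key : ∀ r : ℤ, ((v 0 1 ≤ r ∧ r ≤ v (j - 1) 1) ∨ (v (j - 1) 1 ≤ r ∧ r ≤ v 0 1)) →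
      ((v M 1 ≤ r ∧ r ≤ v (M + j - 1) 1) ∨ (v (M + j - 1) 1 ≤ r ∧ r ≤ v M 1)) → False := fun r hrA hrB =>
    sep_contra hrow (a₁ := 0) (a₂ := j - 1) (b₁ := M) (b₂ := M + j - 1) (by omega) (by omega) r hrA hrB
      (fun a b _ ha2 hb1 hb2 hr => sep0 a b (Nat.zero_le _) (by omega) hb1 (by omega) hr)
      (fun a b _ ha2 hb1 hb2 hr => by
        have := sepj b (a + 2 * M) (by omega) (by omega) (by omega) (by omega) (by rw [hper]; exact hr.symm)
        rwa [hper] at this)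
  rw [show j + M - 1 = M + j - 1 by omega] at dj1
  by_cases hy : v 0 1 + 1 ≤ v j 1
  · exact key (v j 1) (by omega) (by omega)
  · exact key (v 0 1) (by omega) (by omega)

/-- **The forward horizontal cut of a merged honeycomb polygon is unique** (shape FF): for a `2M`-periodic site sequence whose rows move by
at most one per step, two forward cuts `j₁, j₂ < 2M` coincide. [cite: Hammond2015SAPJoining, Definition 4.3 and §4.2 (arXiv v5 pp. 20–24)]
[cite: Madras1995LatticeAnimalsExponent, §2] [cite: MadrasSlade1993, Theorem 3.2.3 proof (pp. 64–65)] -/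
theorem isHdCut_unique (hM : 5 ≤ M) (hper : ∀ i, v (i + 2 * M) = v i)
    (hrow : ∀ i, v (i + 1) 1 ≤ v i 1 + 1 ∧ v i 1 ≤ v (i + 1) 1 + 1) {j₁ j₂ : ℕ} (hj₁ : j₁ < 2 * M) (hj₂ : j₂ < 2 * M)
    (h₁ : IsHdCut M v j₁) (h₂ : IsHdCut M v j₂) : j₁ = j₂ := by
  by_contra hne
  have shift : ∀ a, (∀ i, (fun i => v (i + a)) (i + 2 * M) = (fun i => v (i + a)) i) ∧
      (∀ i, (fun i => v (i + a)) (i + 1) 1 ≤ (fun i => v (i + a)) i 1 + 1 ∧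
        (fun i => v (i + a)) i 1 ≤ (fun i => v (i + a)) (i + 1) 1 + 1) := by
    intro a
    refine ⟨fun i => ?_, fun i => ?_⟩
    · show v (i + 2 * M + a) = v (i + a)
      rw [show i + 2 * M + a = (i + a) + 2 * M by omega, hper]
    · show v (i + 1 + a) 1 ≤ v (i + a) 1 + 1 ∧ v (i + a) 1 ≤ v (i + 1 + a) 1 + 1
      rw [show i + 1 + a = (i + a) + 1 by omega]; exact hrow _
  have key : ∀ {a b : ℕ}, a < b → b ≤ a + M → IsHdCut M v a → IsHdCut M v b → False := by
    intro a b hab hbM ha hb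
    obtain ⟨hper', hrow'⟩ := shift a
    have h0 : IsHdCut M (fun i => v (i + a)) 0 := isHdCut_shift hM (by simpa using ha)
    have hb' : IsHdCut M (fun i => v (i + a)) (b - a) := isHdCut_shift hM (by rw [Nat.add_sub_cancel' hab.le]; exact hb)
    exact not_isHdCut_of_zero hM hper' hrow' h0 (by omega) (by omega) hb'
  rcases Nat.lt_or_gt_of_ne hne with h | h
  · by_cases hd : j₂ ≤ j₁ + M
    · exact key h hd h₁ h₂
    · exact key (show j₂ < j₁ + 2 * M by omega) (by omega) h₂ (isHdCut_add_period hM hper h₁)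
  · by_cases hd : j₁ ≤ j₂ + M
    · exact key h hd h₂ h₁
    · exact key (show j₁ < j₂ + 2 * M by omega) (by omega) h₁ (isHdCut_add_period hM hper h₂)

/-! ### No backward cut next to a forward cut -/

/-- Core case: a forward cut at `0` excludes a backward cut at any `j < 2M`. [cite: Hammond2015SAPJoining, §4.2 (arXiv v5 pp. 20–24)] -/
theorem not_isHdCut'_of_isHdCut_zero (hM : 5 ≤ M) (hper : ∀ i, v (i + 2 * M) = v i)
    (hrow : ∀ i, v (i + 1) 1 ≤ v i 1 + 1 ∧ v i 1 ≤ v (i + 1) 1 + 1) (h0 : IsHdCut M v 0) {j : ℕ} (hj2 : j < 2 * M)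
    (hj : IsHdCut' M v j) : False := by
  obtain ⟨⟨a0, a1⟩, ⟨b0, b1⟩, ⟨c0, c1⟩, ⟨d0, d1⟩, ⟨e0, e1⟩, ⟨f0, f1⟩, ⟨g0, g1⟩, ⟨h0, h1⟩, ⟨i0, i1⟩, sep0⟩ := h0
  obtain ⟨⟨aj0, aj1⟩, ⟨bj0, bj1⟩, ⟨cj0, cj1⟩, ⟨dj0, dj1⟩, ⟨ej0, ej1⟩, ⟨fj0, fj1⟩, ⟨gj0, gj1⟩, ⟨hj0, hj1⟩, ⟨ij0, ij1⟩, sepj⟩ := hj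
  simp only [Nat.zero_add] at a0 a1 b0 b1 c0 c1 d0 d1 e0 e1 f0 f1 g0 g1 h0 h1 i0 i1 sep0
  rcases Nat.lt_or_ge j (M - 3) with hlt | hge
  · -- `j ≤ M − 4`: the arcs `X = [j, M−1]` (rows `y'` … `y₀`) and `Y = [j+M, 2M−1]` (rows `y' − 1` … `y₀ + 1`) overlap in rows
    have key : ∀ r : ℤ, ((v j 1 ≤ r ∧ r ≤ v (M - 1) 1) ∨ (v (M - 1) 1 ≤ r ∧ r ≤ v j 1)) →
        ((v (j + M) 1 ≤ r ∧ r ≤ v (2 * M - 1) 1) ∨ (v (2 * M - 1) 1 ≤ r ∧ r ≤ v (j + M) 1)) → False := fun r hrA hrB =>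
      sep_contra hrow (a₁ := j) (a₂ := M - 1) (b₁ := j + M) (b₂ := 2 * M - 1) (by omega) (by omega) r hrA hrB
        (fun a b ha1 ha2 hb1 hb2 hr => sep0 a b (Nat.zero_le _) (by omega) (by omega) (by omega) hr)
        (fun a b ha1 ha2 hb1 hb2 hr => sepj a b ha1 (by omega) hb1 (by omega) hr)
    by_cases hy : v j 1 ≤ v 0 1
    · exact key (v 0 1) (by omega) (by omega)
    · exact key (v j 1 - 1) (by omega) (by omega)
  by_cases e3 : j = M - 3
  · subst e3
    rw [show M - 3 + 3 = M by omega] at cj0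
    omega
  by_cases e2 : j = M - 2
  · subst e2
    rw [show M - 2 + 2 = M by omega] at bj0
    omega
  by_cases e1 : j = M - 1
  · subst e1
    rw [show M - 1 + 1 = M by omega] at aj0
    omega
  by_cases e0 : j = M
  · subst e0
    rw [show j + j - 1 = 2 * j - 1 by omega] at dj0
    omega
  by_cases e4 : j = M + 1
  · subst e4
    rw [show M + 1 + M - 1 = 0 + 2 * M by omega, hper] at dj1
    rw [show M + 1 + 2 * M - 1 = M + 2 * M by omega, hper] at ij1
    omega
  -- `j = M + k`, `2 ≤ k ≤ M − 1`: the arcs `A = [0, k−1]` and `B = [M, M+k−1]`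
  obtain ⟨k, rfl⟩ : ∃ k, j = M + k := ⟨j - M, by omega⟩
  have hk2 : 2 ≤ k := by omega
  have hkM : k ≤ M - 1 := by omega
  rw [show M + k + M - 1 = (k - 1) + 2 * M by omega, hper] at dj1
  rw [show M + k + 2 * M - 1 = (M + k - 1) + 2 * M by omega, hper] at ij1
  have key : ∀ r : ℤ, ((v 0 1 ≤ r ∧ r ≤ v (k - 1) 1) ∨ (v (k - 1) 1 ≤ r ∧ r ≤ v 0 1)) →
      ((v M 1 ≤ r ∧ r ≤ v (M + k - 1) 1) ∨ (v (M + k - 1) 1 ≤ r ∧ r ≤ v M 1)) → False := fun r hrA hrB =>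
    sep_contra hrow (a₁ := 0) (a₂ := k - 1) (b₁ := M) (b₂ := M + k - 1) (by omega) (by omega) r hrA hrB
      (fun a b _ ha2 hb1 hb2 hr => sep0 a b (Nat.zero_le _) (by omega) hb1 (by omega) hr)
      (fun a b _ ha2 hb1 hb2 hr => by
        have := sepj (a + 2 * M) (b + 2 * M) (by omega) (by omega) (by omega) (by omega) (by rw [hper, hper]; exact hr)
        rwa [hper, hper] at this)
  by_cases hy : v 0 1 + 1 ≤ v (M + k) 1
  · exact key (v 0 1 + 1) (by omega) (by omega)
  · exact key (v 0 1) (by omega) (by omega)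

/-- **A forward and a backward horizontal cut never coexist** (shape FF; `j₁, j₂ < 2M`). [cite: Hammond2015SAPJoining, Definition 4.3 and §4.2 (arXiv v5 pp. 20–24)] [cite: Madras1995LatticeAnimalsExponent, §2] -/
theorem not_isHdCut'_of_isHdCut (hM : 5 ≤ M) (hper : ∀ i, v (i + 2 * M) = v i)
    (hrow : ∀ i, v (i + 1) 1 ≤ v i 1 + 1 ∧ v i 1 ≤ v (i + 1) 1 + 1) {j₁ j₂ : ℕ} (hj₁ : j₁ < 2 * M) (hj₂ : j₂ < 2 * M)
    (h₁ : IsHdCut M v j₁) (h₂ : IsHdCut' M v j₂) : False := by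
  have hper' : ∀ i, (fun i => v (i + j₁)) (i + 2 * M) = (fun i => v (i + j₁)) i := fun i => by
    show v (i + 2 * M + j₁) = v (i + j₁)
    rw [show i + 2 * M + j₁ = (i + j₁) + 2 * M by omega, hper]
  have hrow' : ∀ i, (fun i => v (i + j₁)) (i + 1) 1 ≤ (fun i => v (i + j₁)) i 1 + 1 ∧
      (fun i => v (i + j₁)) i 1 ≤ (fun i => v (i + j₁)) (i + 1) 1 + 1 := fun i => by
    show v (i + 1 + j₁) 1 ≤ v (i + j₁) 1 + 1 ∧ v (i + j₁) 1 ≤ v (i + 1 + j₁) 1 + 1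
    rw [show i + 1 + j₁ = (i + j₁) + 1 by omega]; exact hrow _
  have h0 : IsHdCut M (fun i => v (i + j₁)) 0 := isHdCut_shift hM (by simpa using h₁)
  rcases Nat.lt_or_ge j₂ j₁ with hlt | hge
  · have h₂' := isHdCut'_add_period hM hper h₂
    have hb : IsHdCut' M (fun i => v (i + j₁)) (j₂ + 2 * M - j₁) :=
      isHdCut'_shift hM (by rw [show j₁ + (j₂ + 2 * M - j₁) = j₂ + 2 * M by omega]; exact h₂')
    exact not_isHdCut'_of_isHdCut_zero hM hper' hrow' h0 (by omega) hb
  · have hb : IsHdCut' M (fun i => v (i + j₁)) (j₂ - j₁) :=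
      isHdCut'_shift hM (by rw [Nat.add_sub_cancel' hge]; exact h₂)
    exact not_isHdCut'_of_isHdCut_zero hM hper' hrow' h0 (by omega) hb

end HexBW

end Literature.Probability.RandomPlanarGeometry.SAW
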